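import Literature.Computability.AlgebraicComplexity.CwPowerFlattening
import Mathlib.Algebra.Group.Pi.Units
import HarnessLib

/-!
# Dead labels: a `q`-uniform block decomposition of Koszul flattenings of `T_{cw,q}^{⊠N}`

Topic: `Literature/Computability/AlgebraicComplexity`.  The key structural step of the proof of the
cube case of Conner–Gesmundo–Landsberg–Ventura 2022, Thm. 1.2 (`CGLV2022_thm12_cube`,
`BorderRankCW.lean`: `bR(T_{cw,q}^{⊠3}) = (q+2)³` for all `q > 4`).  The source proves the lower bound
by showing that the `p = 2` Koszul flattening of `φ₃(T_{cw,q}^{⊠3})` has rank `6(q+2)³` for an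
`𝔖_{q-4}^{×3}`-invariant restriction `φ₃ : A^{⊗3} → ℂ⁵`, via the isotypic decomposition of Schur's lemma
and a computer calculation (Thm. 3.4, §§3.3, 3.5, 6).  Here is an ELEMENTARY substitute that needs
no representation theory and no `q`-dependent matrices, PROVED in full generality (`N` factors, any
`p`, alive labels `0, …, s`):

Let `M : A'^* ← (K^{s+1})^{⊗N}` be any restriction matrix on the labels `≤ s`, and extend it BY ZERO to
the labels `≤ q` (`extendPhi s q M`: the labels `s < ℓ ≤ q` are "dead").  Since the support of `T_{cw,q}`
is `{(0,i,i), (i,0,i), (i,i,0)}`, in each tensor factor a dead `B`-label `ℓ` can only be paired with the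
`C`-label `ℓ` (through `a₀`) or `0` (through `a_ℓ`, which the extended restriction kills), and dually.
Hence the Koszul flattening `K_q = K(extendPhi s q M, T_{cw,q}^{⊠N})` is block diagonal with respect to
the DEAD PATTERN `κ : Fin N → Option {dead labels}` of a row/column label (which factors carry which dead
label), and the block of pattern `κ` is — entry by entry — the submatrix of the single matrix
`K_s = K(M, T_{cw,s}^{⊠N})` on the labels whose dead coordinates are frozen to the alive label `s`
(a dead pair `(ℓ, ℓ)` contributes the factor `(T_{cw})_{0ℓℓ} = 1` exactly like `(s, s)`).  Consequently

  `rank K_q ≥ ∑_κ rank K_s[fix_κ] = ∑_{F ⊆ Fin N} (q - s)^{|F|} · rank K_s[fix_F]`,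

a polynomial in `q` whose coefficients are ranks of FIXED matrices (for the cube, `N = 3`, `s = 5`,
`p = 2`: `2058 + 3·294·(q-5) + 3·42·(q-5)² + 6·(q-5)³ = 6(q+2)³`, the count of CGLV's table in the
proof of Thm. 3.4 with `q - 5` in place of `dim V = q - 5`; the eight ranks are kernel certificates,
`CwCubeKoszulCert.lean`, and the assembly is `BorderRankCWThm12Cube.lean`).

* `sum_rank_submatrix_le_rank` — [folklore] blocks with vanishing cross entries: `∑ rank ≤ rank`.
* `extendPhi`, `Dead`, `embLab`, `fixLab`, `rowEmb`, `colEmb`, `fixRow`, `fixCol` — the construction.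
* `cwAlpha_castLE`, `cwAlphaPow_embLab`, `powPhiVal_extendPhi_embLab`,
  `koszulFlattening_extendPhi_embLab` — the block of pattern `κ` IS the frozen submatrix of `K_s`.
* `koszulFlattening_extendPhi_eq_zero_of_ne` — entries between different patterns vanish.
* `sum_blockRank_le_rank_koszulFlattening_extendPhi` — the decomposition (any `N`);
  `cube_blockRank_le_rank_koszulFlattening_extendPhi` — `N = 3` with the count `(q-s)^{|F|}` expanded.

## References

* A. Conner, F. Gesmundo, J. M. Landsberg, E. Ventura, *Rank and border rank of Kronecker powers of
  tensors and Strassen's laser method*, comput. complexity 31 (2022) = arXiv:1909.04785v2, Thm. 1.2,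
  Thm. 3.4 and its proof (the rank count `6(q-5)³ + 3·42(q-5)² + 3·294(q-5) + 2058 = 6(q+2)³`), §6.
  [ConnerGesmundoLandsbergVentura2022]
-/

open scoped BigOperators
open Matrix

namespace Literature.Computability.AlgebraicComplexity

/-! ## Blocks with vanishing cross entries bound the rank from below -/

section BlockRank

/-- **Blocks bound the rank** [folklore]: if `A (ρ w i) (γ w' j) = 0` whenever `w ≠ w'` (entries
between the rows of one block and the columns of another vanish), then
`∑_w rank A[ρ w, γ w] ≤ rank A` (choose an invertible `rank`-minor in each block; their union is a
`blockDiagonal'` of units inside `A`). [folklore] -/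
theorem sum_rank_submatrix_le_rank {F : Type*} [Field F] {m n : Type*} [Fintype m] [Fintype n]
    [DecidableEq m] [DecidableEq n] {ι : Type*} [Fintype ι] [DecidableEq ι] {R C : ι → Type*}
    [∀ w, Fintype (R w)] [∀ w, Fintype (C w)] [∀ w, DecidableEq (R w)] [∀ w, DecidableEq (C w)]
    (A : Matrix m n F) (ρ : ∀ w, R w → m) (γ : ∀ w, C w → n)
    (hoff : ∀ w w' (i : R w) (j : C w'), w ≠ w' → A (ρ w i) (γ w' j) = 0) :
    ∑ w, (A.submatrix (ρ w) (γ w)).rank ≤ A.rank := by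
  classical
  have hmin : ∀ w, ∃ (r : Fin (A.submatrix (ρ w) (γ w)).rank → R w)
      (c : Fin (A.submatrix (ρ w) (γ w)).rank → C w),
      IsUnit ((A.submatrix (ρ w) (γ w)).submatrix r c).det :=
    fun w => Matrix.exists_isUnit_det_submatrix_of_rank _
  choose r c hrc using hmin
  set k : ι → ℕ := fun w => (A.submatrix (ρ w) (γ w)).rank with hk
  set B : Matrix (Σ w, Fin (k w)) (Σ w, Fin (k w)) F :=
    A.submatrix (fun x => ρ x.1 (r x.1 x.2)) (fun y => γ y.1 (c y.1 y.2)) with hB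
  have hBd : B = Matrix.blockDiagonal' (fun w => (A.submatrix (ρ w) (γ w)).submatrix (r w) (c w)) := by
    ext ⟨w, i⟩ ⟨w', j⟩
    by_cases hw : w = w'
    · subst hw
      rw [Matrix.blockDiagonal'_apply_eq]
      rfl
    · rw [Matrix.blockDiagonal'_apply_ne _ _ _ hw]
      exact hoff w w' _ _ hw
  have hunit : IsUnit B := by
    rw [hBd]
    have hu : IsUnit (fun w => (A.submatrix (ρ w) (γ w)).submatrix (r w) (c w)) :=
      Pi.isUnit_iff.2 fun w => (Matrix.isUnit_iff_isUnit_det _).2 (hrc w)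
    exact hu.map (Matrix.blockDiagonal'RingHom (fun w => Fin (k w)) F)
  have hdetB : B.det ≠ 0 := ((Matrix.isUnit_iff_isUnit_det _).1 hunit).ne_zero
  have hle := Literature.LinearAlgebra.Matrix.card_le_rank_of_det_submatrix_ne_zero A _ _ hdetB
  simpa [Fintype.card_sigma, hk] using hle

end BlockRank

/-! ## The construction: extension by zero, dead patterns, embeddings -/

section Construction

variable (K : Type*) [CommRing K] {m N : ℕ}

/-- **Extension by zero** of a restriction matrix `M` on the labels `≤ s` to the labels `≤ q`:
`(extendPhi s q M)_{e, x} = M_{e, x}` if every coordinate of `x ∈ (Fin (q+1))^N` is `≤ s`, else `0`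
(the labels `> s` are dead). [folklore] -/
def extendPhi (s q : ℕ) (M : Matrix (Fin m) (Fin N → Fin (s + 1)) K) :
    Matrix (Fin m) (Fin N → Fin (q + 1)) K :=
  Matrix.of fun e x =>
    if h : ∀ l, (x l : ℕ) ≤ s then M e (fun l => ⟨x l, Nat.lt_succ_of_le (h l)⟩) else 0

variable {K}

/-- The extension vanishes at a label with a dead coordinate. [folklore] -/
theorem extendPhi_eq_zero {s q : ℕ} (M : Matrix (Fin m) (Fin N → Fin (s + 1)) K) (e : Fin m)
    {x : Fin N → Fin (q + 1)} {l : Fin N} (hl : s < (x l : ℕ)) : extendPhi K s q M e x = 0 := by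
  unfold extendPhi
  rw [Matrix.of_apply, dif_neg]
  exact fun h => absurd (h l) (not_le.2 hl)

/-- The extension agrees with `M` on relabelled alive labels. [folklore] -/
theorem extendPhi_castLE {s q : ℕ} (hsq : s + 1 ≤ q + 1) (M : Matrix (Fin m) (Fin N → Fin (s + 1)) K)
    (e : Fin m) (a : Fin N → Fin (s + 1)) :
    extendPhi K s q M e (fun l => Fin.castLE hsq (a l)) = M e a := by
  unfold extendPhi
  rw [Matrix.of_apply, dif_pos (fun l => by simpa using Nat.lt_succ_iff.1 (a l).isLt)]
  rfl

/-- Integer extensions cast to extensions over any ring. [folklore] -/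
theorem extendPhi_map_intCast {s q : ℕ} (M : Matrix (Fin m) (Fin N → Fin (s + 1)) ℤ) :
    (extendPhi ℤ s q M).map (Int.castRingHom K) = extendPhi K s q (M.map (Int.castRingHom K)) := by
  ext e x
  simp only [Matrix.map_apply, extendPhi, Matrix.of_apply]
  split_ifs <;> simp

/-- The dead labels: `s < ℓ ≤ q`. [folklore] -/
abbrev Dead (s q : ℕ) : Type := {ℓ : Fin (q + 1) // s < (ℓ : ℕ)}

/-- The dead labels are `s + 1, …, q`: an enumeration by `Fin (q - s)`. [folklore] -/
def deadEquiv (s q : ℕ) : Dead s q ≃ Fin (q - s) where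
  toFun ℓ := ⟨(ℓ.1 : ℕ) - (s + 1), by have := ℓ.2; have := ℓ.1.isLt; omega⟩
  invFun i := ⟨⟨(i : ℕ) + (s + 1), by omega⟩, by change s < (i : ℕ) + (s + 1); omega⟩
  left_inv ℓ := by
    have := ℓ.2
    ext
    simp only
    omega
  right_inv i := by
    ext
    simp

/-- There are `q - s` dead labels. [folklore] -/
theorem card_dead (s q : ℕ) : Fintype.card (Dead s q) = q - s := by
  rw [Fintype.card_congr (deadEquiv s q), Fintype.card_fin]

variable {s q : ℕ}

/-- The label in `(Fin (q+1))^N` of dead pattern `κ` with alive coordinates `x`: dead coordinates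
carry their dead label, alive ones the relabelled `x l`. [folklore] -/
def embLab (hsq : s + 1 ≤ q + 1) (κ : Fin N → Option (Dead s q)) (x : Fin N → Fin (s + 1)) :
    Fin N → Fin (q + 1) :=
  fun l => match κ l with
    | some ℓ => ℓ.1
    | none => Fin.castLE hsq (x l)

/-- Freezing the coordinates in `F` to the alive label `s`. [folklore] -/
def fixLab (F : Fin N → Bool) (x : Fin N → Fin (s + 1)) : Fin N → Fin (s + 1) :=
  fun l => if F l then Fin.last s else x l

/-- The dead set of a pattern. [folklore] -/
def deadSet (κ : Fin N → Option (Dead s q)) : Fin N → Bool := fun l => (κ l).isSome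

/-- A dead coordinate carries its dead label. [folklore] -/
theorem embLab_some {hsq : s + 1 ≤ q + 1} {κ : Fin N → Option (Dead s q)} {x : Fin N → Fin (s + 1)}
    {l : Fin N} {ℓ : Dead s q} (h : κ l = some ℓ) : embLab hsq κ x l = ℓ.1 := by
  simp [embLab, h]

/-- An alive coordinate carries the relabelled alive label. [folklore] -/
theorem embLab_none {hsq : s + 1 ≤ q + 1} {κ : Fin N → Option (Dead s q)} {x : Fin N → Fin (s + 1)}
    {l : Fin N} (h : κ l = none) : embLab hsq κ x l = Fin.castLE hsq (x l) := by
  simp [embLab, h]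

/-- Freezing a dead coordinate. [folklore] -/
theorem fixLab_of_some {κ : Fin N → Option (Dead s q)} {x : Fin N → Fin (s + 1)} {l : Fin N}
    {ℓ : Dead s q} (h : κ l = some ℓ) : fixLab (deadSet κ) x l = Fin.last s := by
  simp [fixLab, deadSet, h]

/-- Freezing does not touch alive coordinates. [folklore] -/
theorem fixLab_of_none {κ : Fin N → Option (Dead s q)} {x : Fin N → Fin (s + 1)} {l : Fin N}
    (h : κ l = none) : fixLab (deadSet κ) x l = x l := by
  simp [fixLab, deadSet, h]

/-- Patterns are determined by their labels: the images of `embLab` for different patterns are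
disjoint. [folklore] -/
theorem eq_of_embLab_eq {hsq : s + 1 ≤ q + 1} {κ κ' : Fin N → Option (Dead s q)}
    {x x' : Fin N → Fin (s + 1)} (h : embLab hsq κ x = embLab hsq κ' x') : κ = κ' := by
  funext l
  have hl := congr_fun h l
  rcases hκ : κ l with _ | ℓ <;> rcases hκ' : κ' l with _ | ℓ'
  · rfl
  · rw [embLab_none hκ, embLab_some hκ'] at hl
    have h1 : ((Fin.castLE hsq (x l) : Fin (q + 1)) : ℕ) = (ℓ'.1 : ℕ) := by rw [hl]
    have h2 := ℓ'.2
    have h3 := (x l).isLt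
    simp only [Fin.val_castLE] at h1
    omega
  · rw [embLab_some hκ, embLab_none hκ'] at hl
    have h1 : ((ℓ.1 : Fin (q + 1)) : ℕ) = (Fin.castLE hsq (x' l) : ℕ) := by rw [hl]
    have h2 := ℓ.2
    have h3 := (x' l).isLt
    simp only [Fin.val_castLE] at h1
    omega
  · rw [embLab_some hκ, embLab_some hκ'] at hl
    rw [Subtype.ext hl]

variable (p : ℕ)

/-- Row `(T, x)` of the `s`-level flattening placed in pattern `κ` at level `q`. [folklore] -/
def rowEmb (hsq : s + 1 ≤ q + 1) (κ : Fin N → Option (Dead s q))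
    (r : PSub (2 * p + 1) (p + 1) × (Fin N → Fin (s + 1))) :
    PSub (2 * p + 1) (p + 1) × (Fin N → Fin (q + 1)) :=
  (r.1, embLab hsq κ r.2)

/-- Column `(S, x)` of the `s`-level flattening placed in pattern `κ` at level `q`. [folklore] -/
def colEmb (hsq : s + 1 ≤ q + 1) (κ : Fin N → Option (Dead s q))
    (c : PSub (2 * p + 1) p × (Fin N → Fin (s + 1))) : PSub (2 * p + 1) p × (Fin N → Fin (q + 1)) :=
  (c.1, embLab hsq κ c.2)

/-- Row `(T, x)` with the coordinates in `F` frozen to the label `s`. [folklore] -/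
def fixRow (F : Fin N → Bool) (r : PSub (2 * p + 1) (p + 1) × (Fin N → Fin (s + 1))) :
    PSub (2 * p + 1) (p + 1) × (Fin N → Fin (s + 1)) :=
  (r.1, fixLab F r.2)

/-- Column `(S, x)` with the coordinates in `F` frozen to the label `s`. [folklore] -/
def fixCol (F : Fin N → Bool) (c : PSub (2 * p + 1) p × (Fin N → Fin (s + 1))) :
    PSub (2 * p + 1) p × (Fin N → Fin (s + 1)) :=
  (c.1, fixLab F c.2)

end Construction

/-! ## The block of pattern `κ` is the frozen submatrix of the `s`-level flattening -/

section Entries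

variable {K : Type*} [CommRing K] {N s q : ℕ}

/-- Relabelling alive labels does not change `α`. [cite: ConnerGesmundoLandsbergVentura2022, eq. (1)] -/
theorem cwAlpha_castLE (hsq : s + 1 ≤ q + 1) (x y : Fin (s + 1)) :
    cwAlpha q (Fin.castLE hsq x) (Fin.castLE hsq y) = (cwAlpha s x y).map (Fin.castLE hsq) := by
  have hinj : ∀ {a b : Fin (s + 1)}, Fin.castLE hsq a = Fin.castLE hsq b ↔ a = b := fun {a b} =>
    (Fin.castLE_injective hsq).eq_iff
  have h0 : ∀ {a : Fin (s + 1)}, Fin.castLE hsq a = 0 ↔ a = 0 := fun {a} => by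
    rw [← hinj (a := a) (b := 0)]; rfl
  unfold cwAlpha
  simp only [ne_eq, hinj, h0]
  split_ifs <;> rfl

/-- A dead pair `(ℓ, ℓ)` has `α = 0`, like the alive pair `(s, s)` (`s ≠ 0`).
[cite: ConnerGesmundoLandsbergVentura2022, eq. (1)] -/
theorem cwAlpha_dead (ℓ : Dead s q) : cwAlpha q ℓ.1 ℓ.1 = some 0 :=
  cwAlpha_self fun h => by have := ℓ.2; rw [h] at this; simp at this

/-- `α(s, s) = 0` for the alive label `s ≠ 0`. [cite: ConnerGesmundoLandsbergVentura2022, eq. (1)] -/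
theorem cwAlpha_last (hs : 0 < s) : cwAlpha s (Fin.last s) (Fin.last s) = some 0 :=
  cwAlpha_self fun h => by
    have := congrArg Fin.val h
    rw [Fin.val_last, Fin.val_zero] at this
    omega

/-- Factorwise comparison of `α` along the embedding of pattern `κ` and the freezing of its dead
set. [cite: ConnerGesmundoLandsbergVentura2022, eq. (1)] -/
theorem cwAlpha_embLab (hs : 0 < s) (hsq : s + 1 ≤ q + 1) (κ : Fin N → Option (Dead s q))
    (b c : Fin N → Fin (s + 1)) (l : Fin N) :
    cwAlpha q (embLab hsq κ b l) (embLab hsq κ c l) =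
      (cwAlpha s (fixLab (deadSet κ) b l) (fixLab (deadSet κ) c l)).map (Fin.castLE hsq) := by
  rcases hκ : κ l with _ | ℓ
  · rw [embLab_none hκ, embLab_none hκ, fixLab_of_none hκ, fixLab_of_none hκ, cwAlpha_castLE]
  · rw [embLab_some hκ, embLab_some hκ, fixLab_of_some hκ, fixLab_of_some hκ, cwAlpha_dead,
      cwAlpha_last hs]
    rfl

/-- The support function along pattern `κ` is the relabelled support function of the frozen
labels. [cite: ConnerGesmundoLandsbergVentura2022, eq. (1)] -/
theorem cwAlphaPow_embLab (hs : 0 < s) (hsq : s + 1 ≤ q + 1) (κ : Fin N → Option (Dead s q))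
    (b c : Fin N → Fin (s + 1)) :
    cwAlphaPow q N (embLab hsq κ b) (embLab hsq κ c) =
      (cwAlphaPow s N (fixLab (deadSet κ) b) (fixLab (deadSet κ) c)).map
        (fun a l => Fin.castLE hsq (a l)) := by
  rcases h : cwAlphaPow s N (fixLab (deadSet κ) b) (fixLab (deadSet κ) c) with _ | a
  · obtain ⟨l, hl⟩ := cwAlphaPow_eq_none_iff.1 h
    rw [Option.map_none, cwAlphaPow_eq_none_iff]
    exact ⟨l, by rw [cwAlpha_embLab hs hsq, hl]; rfl⟩
  · rw [Option.map_some, cwAlphaPow_eq_some_iff]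
    intro l
    rw [cwAlpha_embLab hs hsq, cwAlphaPow_eq_some_iff.1 h l]
    rfl

/-- The slices along pattern `κ` are the slices of the frozen labels.
[cite: ConnerGesmundoLandsbergVentura2022, Thm. 3.4 (proof)] -/
theorem powPhiVal_extendPhi_embLab {p : ℕ} (hs : 0 < s) (hsq : s + 1 ≤ q + 1)
    (M : Matrix (Fin (2 * p + 1)) (Fin N → Fin (s + 1)) K) (κ : Fin N → Option (Dead s q))
    (j : Fin (2 * p + 1)) (b c : Fin N → Fin (s + 1)) :
    powPhiVal (extendPhi K s q M) j (embLab hsq κ b) (embLab hsq κ c) =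
      powPhiVal M j (fixLab (deadSet κ) b) (fixLab (deadSet κ) c) := by
  rcases h : cwAlphaPow s N (fixLab (deadSet κ) b) (fixLab (deadSet κ) c) with _ | a
  · rw [powPhiVal_of_none M j h, powPhiVal_of_none]
    rw [cwAlphaPow_embLab hs hsq, h]
    rfl
  · rw [powPhiVal_of_some M j h, powPhiVal_of_some (extendPhi K s q M) j
      (a := fun l => Fin.castLE hsq (a l)) (by rw [cwAlphaPow_embLab hs hsq, h]; rfl)]
    exact extendPhi_castLE hsq M j a

/-- **The block of pattern `κ` is the frozen submatrix**: entry by entry,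
`K_q(rowEmb κ r, colEmb κ c) = K_s(fixRow r, fixCol c)`.
[cite: ConnerGesmundoLandsbergVentura2022, Thm. 3.4 (proof)] -/
theorem koszulFlattening_extendPhi_embLab (p : ℕ) (hs : 0 < s) (hsq : s + 1 ≤ q + 1)
    (M : Matrix (Fin (2 * p + 1)) (Fin N → Fin (s + 1)) K) (κ : Fin N → Option (Dead s q))
    (r : PSub (2 * p + 1) (p + 1) × (Fin N → Fin (s + 1)))
    (c : PSub (2 * p + 1) p × (Fin N → Fin (s + 1))) :
    koszulFlattening p (extendPhi K s q M).mulVecLin (kroneckerPow (cwTensor K q) N)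
        (rowEmb p hsq κ r) (colEmb p hsq κ c) =
      koszulFlattening p M.mulVecLin (kroneckerPow (cwTensor K s) N)
        (fixRow p (deadSet κ) r) (fixCol p (deadSet κ) c) := by
  rw [koszulFlattening_cwPow_apply, koszulFlattening_cwPow_apply]
  refine Finset.sum_congr rfl fun j _ => ?_
  simp only [rowEmb, colEmb, fixRow, fixCol]
  rw [powPhiVal_extendPhi_embLab hs hsq]

/-- As matrices: the block of pattern `κ` of `K_q` is the frozen submatrix of `K_s`.
[cite: ConnerGesmundoLandsbergVentura2022, Thm. 3.4 (proof)] -/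
theorem submatrix_koszulFlattening_extendPhi (p : ℕ) (hs : 0 < s) (hsq : s + 1 ≤ q + 1)
    (M : Matrix (Fin (2 * p + 1)) (Fin N → Fin (s + 1)) K) (κ : Fin N → Option (Dead s q)) :
    (koszulFlattening p (extendPhi K s q M).mulVecLin (kroneckerPow (cwTensor K q) N)).submatrix
        (rowEmb p hsq κ) (colEmb p hsq κ) =
      (koszulFlattening p M.mulVecLin (kroneckerPow (cwTensor K s) N)).submatrix
        (fixRow p (deadSet κ)) (fixCol p (deadSet κ)) := by
  ext r c
  exact koszulFlattening_extendPhi_embLab p hs hsq M κ r c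

/-- **Support**: a column of pattern `κ` is supported on the rows of pattern `κ`.
[cite: ConnerGesmundoLandsbergVentura2022, Thm. 3.4 (proof)] -/
theorem exists_rowEmb_of_ne_zero (p : ℕ) (hsq : s + 1 ≤ q + 1)
    (M : Matrix (Fin (2 * p + 1)) (Fin N → Fin (s + 1)) K) (κ : Fin N → Option (Dead s q))
    (ρ : PSub (2 * p + 1) (p + 1) × (Fin N → Fin (q + 1))) (c : PSub (2 * p + 1) p × (Fin N → Fin (s + 1)))
    (h : koszulFlattening p (extendPhi K s q M).mulVecLin (kroneckerPow (cwTensor K q) N) ρ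
      (colEmb p hsq κ c) ≠ 0) :
    ∃ r, rowEmb p hsq κ r = ρ := by
  obtain ⟨j, a, -, -, ha, hM⟩ := exists_of_koszulFlattening_cwPow_ne_zero p _ ρ _ h
  -- every coordinate of `a` is alive
  have halive : ∀ l, (a l : ℕ) ≤ s := by
    by_contra hne
    push Not at hne
    obtain ⟨l, hl⟩ := hne
    exact hM (extendPhi_eq_zero M j hl)
  rw [cwAlphaPow_eq_some_iff] at ha
  -- the `C`-label of `ρ` in each factor
  have hlab : ∀ l, (∀ ℓ, κ l = some ℓ → ρ.2 l = ℓ.1) ∧ (κ l = none → (ρ.2 l : ℕ) ≤ s) := by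
    intro l
    have hal := ha l
    change cwAlpha q (embLab hsq κ c.2 l) (ρ.2 l) = some (a l) at hal
    constructor
    · intro ℓ hℓ
      rw [embLab_some hℓ] at hal
      rcases cwAlpha_some_cases hal with ⟨-, h2, -⟩ | ⟨h1, -, -⟩ | ⟨-, -, h3⟩
      · exact h2.symm
      · exfalso
        have h1' := congrArg Fin.val h1
        rw [Fin.val_zero] at h1'
        have := ℓ.2
        omega
      · exact absurd (halive l) (by rw [h3]; exact not_le.2 ℓ.2)
    · intro hnone
      rw [embLab_none hnone] at hal
      rcases cwAlpha_some_cases hal with ⟨-, h2, -⟩ | ⟨-, -, h3⟩ | ⟨h1, -, -⟩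
      · rw [← h2]; simpa using Nat.lt_succ_iff.1 (c.2 l).isLt
      · rw [← h3]; exact halive l
      · rw [h1]; simp
  set x : Fin N → Fin (s + 1) :=
    fun l => if h : (ρ.2 l : ℕ) ≤ s then ⟨ρ.2 l, Nat.lt_succ_of_le h⟩ else Fin.last s with hx
  refine ⟨(ρ.1, x), Prod.ext rfl ?_⟩
  change embLab hsq κ x = ρ.2
  funext l
  rcases hκ : κ l with _ | ℓ
  · rw [embLab_none hκ, hx]
    dsimp only
    rw [dif_pos ((hlab l).2 hκ)]
    ext
    simp
  · rw [embLab_some hκ, (hlab l).1 ℓ hκ]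

/-- **Vanishing across patterns**: entries between the rows of pattern `κ` and the columns of a
different pattern `κ'` are zero. [cite: ConnerGesmundoLandsbergVentura2022, Thm. 3.4 (proof)] -/
theorem koszulFlattening_extendPhi_eq_zero_of_ne (p : ℕ) (hsq : s + 1 ≤ q + 1)
    (M : Matrix (Fin (2 * p + 1)) (Fin N → Fin (s + 1)) K) {κ κ' : Fin N → Option (Dead s q)}
    (r : PSub (2 * p + 1) (p + 1) × (Fin N → Fin (s + 1))) (c : PSub (2 * p + 1) p × (Fin N → Fin (s + 1)))
    (hne : κ ≠ κ') :
    koszulFlattening p (extendPhi K s q M).mulVecLin (kroneckerPow (cwTensor K q) N)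
      (rowEmb p hsq κ r) (colEmb p hsq κ' c) = 0 := by
  by_contra h
  obtain ⟨r', hr'⟩ := exists_rowEmb_of_ne_zero p hsq M κ' _ c h
  have := congrArg Prod.snd hr'
  simp only [rowEmb] at this
  exact hne (eq_of_embLab_eq this).symm

end Entries

/-! ## The decomposition -/

section Decomposition

variable {K : Type*} [Field K] {N s q : ℕ}

/-- The rank of the frozen submatrix of the `s`-level flattening for a dead set `F`.
[cite: ConnerGesmundoLandsbergVentura2022, Thm. 3.4 (proof)] -/
noncomputable def blockRank (p : ℕ) (M : Matrix (Fin (2 * p + 1)) (Fin N → Fin (s + 1)) K)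
    (F : Fin N → Bool) : ℕ :=
  ((koszulFlattening p M.mulVecLin (kroneckerPow (cwTensor K s) N)).submatrix
    (fixRow p F) (fixCol p F)).rank

/-- **The dead-label decomposition** (any number `N` of factors, any `p`, alive labels `0, …, s`
with `0 < s ≤ q`): `∑_κ blockRank (deadSet κ) ≤ rank K(extendPhi s q M, T_{cw,q}^{⊠N})`, the sum
over all dead patterns `κ : Fin N → Option {dead labels}`.
[cite: ConnerGesmundoLandsbergVentura2022, Thm. 3.4 (proof)] -/
theorem sum_blockRank_le_rank_koszulFlattening_extendPhi (p : ℕ) (hs : 0 < s) (hsq : s ≤ q)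
    (M : Matrix (Fin (2 * p + 1)) (Fin N → Fin (s + 1)) K) :
    ∑ κ : Fin N → Option (Dead s q), blockRank p M (deadSet κ) ≤
      (koszulFlattening p (extendPhi K s q M).mulVecLin (kroneckerPow (cwTensor K q) N)).rank := by
  have hsq' : s + 1 ≤ q + 1 := by omega
  have key := sum_rank_submatrix_le_rank
    (koszulFlattening p (extendPhi K s q M).mulVecLin (kroneckerPow (cwTensor K q) N))
    (fun κ => rowEmb p hsq' κ) (fun κ => colEmb p hsq' κ)
    (fun κ κ' r c hne => koszulFlattening_extendPhi_eq_zero_of_ne p hsq' M r c hne)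
  refine le_trans (le_of_eq (Finset.sum_congr rfl fun κ _ => ?_)) key
  unfold blockRank
  rw [submatrix_koszulFlattening_extendPhi p hs hsq' M κ]

/-- Summing a function of the dead SET over all dead PATTERNS of three factors: each dead
coordinate can carry any of the `d = q - s` dead labels. [folklore] -/
theorem sum_deadSet_three (d : ℕ) (hd : Fintype.card (Dead s q) = d) (g : (Fin 3 → Bool) → ℕ) :
    ∑ κ : Fin 3 → Option (Dead s q), g (deadSet κ) =
      g ![false, false, false] +
        d * (g ![true, false, false] + g ![false, true, false] + g ![false, false, true]) +
        d ^ 2 * (g ![true, true, false] + g ![true, false, true] + g ![false, true, true]) +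
        d ^ 3 * g ![true, true, true] := by
  -- split off the three coordinates one at a time
  have step : ∀ (h : (Fin 3 → Option (Dead s q)) → ℕ),
      ∑ κ, h κ = ∑ o₀ : Option (Dead s q), ∑ o₁ : Option (Dead s q), ∑ o₂ : Option (Dead s q),
        h ![o₀, o₁, o₂] := by
    intro h
    rw [← Equiv.sum_comp (Fin.consEquiv fun _ => Option (Dead s q)), Fintype.sum_prod_type]
    refine Fintype.sum_congr _ _ fun o₀ => ?_
    rw [← Equiv.sum_comp (Fin.consEquiv fun _ => Option (Dead s q)), Fintype.sum_prod_type]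
    refine Fintype.sum_congr _ _ fun o₁ => ?_
    rw [← Equiv.sum_comp (Fin.consEquiv fun _ => Option (Dead s q)), Fintype.sum_prod_type]
    refine Fintype.sum_congr _ _ fun o₂ => ?_
    rw [Fintype.sum_unique]
    rfl
  have hds : ∀ o₀ o₁ o₂ : Option (Dead s q),
      deadSet ![o₀, o₁, o₂] = ![o₀.isSome, o₁.isSome, o₂.isSome] := by
    intro o₀ o₁ o₂
    funext l
    fin_cases l <;> rfl
  rw [step]
  simp only [hds, Fintype.sum_option, Option.isSome_none, Option.isSome_some, Finset.sum_const,
    Finset.card_univ, hd, smul_eq_mul]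
  ring

/-- **The decomposition for the cube** (`N = 3`, the case of CGLV Thm. 3.4): with `d = q - s`,
`r_∅ + d (r_0 + r_1 + r_2) + d² (r_01 + r_02 + r_12) + d³ r_012 ≤ rank K(extendPhi s q M, T_{cw,q}^{⊠3})`,
where `r_F` is the rank of the frozen submatrix of `K(M, T_{cw,s}^{⊠3})` for the dead set `F`.
[cite: ConnerGesmundoLandsbergVentura2022, Thm. 3.4 (proof)] -/
theorem cube_blockRank_le_rank_koszulFlattening_extendPhi (p : ℕ) (hs : 0 < s) (hsq : s ≤ q)
    (M : Matrix (Fin (2 * p + 1)) (Fin 3 → Fin (s + 1)) K) :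
    blockRank p M ![false, false, false] +
        (q - s) * (blockRank p M ![true, false, false] + blockRank p M ![false, true, false] +
          blockRank p M ![false, false, true]) +
        (q - s) ^ 2 * (blockRank p M ![true, true, false] + blockRank p M ![true, false, true] +
          blockRank p M ![false, true, true]) +
        (q - s) ^ 3 * blockRank p M ![true, true, true] ≤
      (koszulFlattening p (extendPhi K s q M).mulVecLin (kroneckerPow (cwTensor K q) 3)).rank := by
  rw [← sum_deadSet_three (q - s) (card_dead s q) (blockRank p M)]
  exact sum_blockRank_le_rank_koszulFlattening_extendPhi p hs hsq M

/-- The frozen submatrix for the empty dead set is the whole `s`-level flattening. [folklore] -/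
theorem blockRank_none (p : ℕ) (M : Matrix (Fin (2 * p + 1)) (Fin N → Fin (s + 1)) K) :
    blockRank p M (fun _ => false) =
      (koszulFlattening p M.mulVecLin (kroneckerPow (cwTensor K s) N)).rank := by
  rfl

end Decomposition

end Literature.Computability.AlgebraicComplexity
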